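import Literature.NumberTheory.Automorphic.Liu2021.AppendixC.DefC1toC3
import Literature.NumberTheory.Automorphic.Liu2021.AppendixC.PropC5
import Literature.AlgebraicGeometry.ShimuraVarieties.UnitaryAuxiliaryTorusDatum
import Mathlib.AlgebraicGeometry.Morphisms.Proper
import Mathlib.NumberTheory.RamificationInertia.Basic
import HarnessLib

/-!
# Liu 2021, Appendix C §C.3 «Their connection» (Lem. C.14, Rem. C.15, Def. C.16, Rem. C.17, Lem. C.18) and the
# opening of §C.4 (Def. C.19) — STATEMENTS AS PRINTED (typer carpet: named facts and interfaces; NO proofs)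

[Liu2021] = Yifeng Liu, *Fourier–Jacobi cycles and arithmetic relative trace formula* (with an appendix by Chao Li and
Yihang Zhu), Cambridge J. Math. **9** (2021), no. 1, 1–147 = arXiv:2102.11518.  PAGES READ FOR THIS FILE: the print text
(`lit read paper:liu2021-fourier-jacobi-cycles-arithmetic-relative-trace-formula`, pages p0112–p0117 = journal pp. 112–117)
and the author's TeX source `FJcycle.tex` (md5 `6db49a74122d2cb0f224fa1b39488a0c`; «l. NNNN» below).  NUMBERING (one
counter for all environments of App. C, as in the sibling files): **C.14** = Lemma `le:reflex` (p. 113; l. 4789–4791,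
proof l. 4793–4795) · **C.15** = Remark (p. 113; l. 4797–4799) · **C.16** = Definition `de:moduli_connection` (pp. 114–115;
l. 4827–4857) · **C.17** = Remark (p. 115; l. 4860–4862) · **C.18** = Lemma `le:shimura_variety` (p. 115; l. 4865–4872,
proof l. 4874–4894) · **C.19** = Definition `de:integral_connection` (pp. 116–117; l. 4921–4952); displays **(C.3)** =
`eq:shimura_data` (p. 113), **(C.4)** = `eq:shimura_varieties` (p. 114), **(C.5)** = `eq:shimura_varieties1` (p. 114;
l. 4819–4823), **(C.6)** = `eq:shimura_varieties2` (p. 115; l. 4881), **(C.7)** = `eq:integral_canonical` (p. 117; l. 4955–4958).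

**ED.2 (review-class fix after the squad's RETRO-AUDIT; statements byte-identical to ED.1 except (C.5), Lem. C.18 and the
datum of Def. C.19).**  (i) L1 — (C.4)∕(C.5) and Lem. C.18 («Let the notation be as above») are printed for NEAT levels only
(l. 4810: «For neat open compact subgroups `K ⊆ G(𝔸^∞)`, `L₀ ⊆ H₀(𝔸^∞)` …»); ED.1 claimed them at every open compact level.
Now `IsoC5AsPrinted D` and `LemC18AsPrinted D` are guarded by «neat»: `SecC3Data.IsNeatK` (READ OFF the pinned sibling datum,
next point) and the ⟨CARRIER⟩ predicate `SecC3Data.IsNeatL0` («neat» is not defined in [Liu2021]; READING R8, exactly as the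
siblings `DefC1toC3.ShimuraSystemFlat.IsNeat` and `SecC2Similitude.SecC2Data.IsLevel`).  (i′) L2∕pin — the left node
`{Sh(G, h♭_{V,Φ})_K}_K` is no longer a second free functor: `SecC3Data.S : V.ShimuraSystemFlat Φ` IS the sibling's carrier of
§C.1 (with its printed attributes), and `SecC3Data.ShV = shVOf D.S` is read off it (same name and type as the ED.1 field).
The other functor carriers stay posited, cross-checked: the tree's ★ `AlgebraicGeometry.Liu2021.AlbaneseUnitaryShimura`
(`LiuAlbaneseDatum`, bare `Level`∕`Isog` carriers) is the INCOHERENT `Sh(𝕍)_K` of §4.2 over `E`, not App. C's coherent data,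
and ★ `SecC2Similitude.SecC2Data.Sh`∕`PointSet` (Def. C.11∕C.12) index the `H`-levels by subgroups of `GL_1(E ⊗ 𝔸^∞)` over
`typeReflexField (Φ^c)`, whereas `Sh0`∕`M0` here are indexed by the tree torus `H0fin ≤ 𝔸_E^{∞,×}` over `cmReflexField Φ` — the
same objects in two presentations; a bridge (torus `E ⊗ 𝔸^∞ ≃ 𝔸_E^∞`, `E_Φ = E_{Φ^c}`) is wanted, not typed here.
(ii) L2 — the base `O_{E♯_{V,Φ,𝔭}}` of Def. C.19 was a free carrier; it is now pinned by
the REAL place of `E♯_{V,Φ}` it completes (`DefC19Data.placeSharp`, a nonzero prime of `𝓞_{E♯_{V,Φ}}` above `p`,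
`placeSharp_under`) and the REAL-typed structure map `𝓞_{E♯_{V,Φ}} → O_{E♯_{V,Φ,𝔭}}` (`algOsharp`) whose non-units are exactly
`placeSharp` (`algOsharp_isUnit_iff`); the completion itself stays a ⟨CARRIER⟩ (see the field).  Nothing else changed.

## What this file is and how it types (same discipline as `DefC1toC3.lean`, `PropC5.lean`, `Glue.lean` of this directory)

Squad TL «Liu FJ∕418» carpet of App. C §C.3 (deal SPLIT-TL.v1, typer TL-t05).  Three layers:
1. **REAL** (genuine Mathlib / tree objects): the reflex field `E_Φ` of a CM type read AS PRINTED in App. C (§C.2,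
   l. 4683: «the fixed field of the stabilizer of `Ψ` in `Gal(ℂ/ℚ)`», here `Ψ = Φ ∈ ℕ[Φ_E]`) = `cmReflexField`, on the
   `Gal(ℂ/ℚ)`-action / `stabilizer` of `DefC1toC3`; the field `E♯_{V,Φ}` of Lem. C.14 = `sharpReflexField` (the subfield of
   `ℂ` generated by `E♭_{V,Φ}` and `E_Φ` = their `⊔` in `IntermediateField ℚ ℂ`); **Lemma C.14** and the first sentence of
   **Remark C.15** as CLOSED named facts `LemC14AsPrinted`, `RemC15AsPrinted : Prop` over `HermSpace.reflexField` /
   `reducedReflexField` / `IsSignatureN1At` of `DefC1toC3`; the index groups of the Shimura varieties: `G(𝔸^∞) =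
   U(V)(𝔸_F^∞)` = `HermSpace.Gfin` (`DefC1toC3`) and `H₀(𝔸^∞)` = the tree's torus `UnitaryCanonicalModel.Aux.torusFinAdelic`
   (`Literature/AlgebraicGeometry/ShimuraVarieties/UnitaryAuxiliaryTorusDatum`, which IS the group of rational similitudes
   of a rank-one skew-hermitian space, [Liu2021] Def. C.11 with `n = 1`: `H₀(R) = {h ∈ (E ⊗_ℚ R)^× | h h^c ∈ R^×}` for every
   `W₀`), their open compact subgroups (`C5.OpenCompactSubgroup` of `PropC5`), base change of schemes over a field along
   the REAL inclusions `E♭_{V,Φ} ≤ E♯_{V,Φ}`, `E_Φ ≤ E♯_{V,Φ}` (`C5.baseChangeAlong`), fibre products in `Sch_{/E♯}` (the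
   cartesian monoidal structure `⊗` of the tree's `SchemeOver` = Mathlib `Over (Spec _)`), `IsIso`, `IsSeparated`,
   `IsProper`; the number-theoretic hypotheses of Def. C.19 (`𝔭` inert in `E`, `p` odd and unramified in `E`, `τ' ∈ Φ`,
   signature `(n−1,1)` at `τ'|_F`).
2. **⟨CARRIER⟩** (posited data standing for printed objects Mathlib ∕ the tree cannot construct — canonical models of
   Shimura varieties, PEL ∕ RSZ moduli schemes, the completed reflex field at `𝔭`): fields of the hypothesis structures
   `SecC3Data V Φ` (§C.3) and `DefC19Data V Φ` (Def. C.19), each quoting the printed definition of the object it stands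
   for.  Def. C.10 ∕ C.11 ∕ C.12 (§C.2, typed by TL-t04 in ★ `AppendixC/SecC2Similitude.lean`) enter ONLY through
   the tokens `W0inf`, `W0` and the systems `Sh0`, `M0`; this file does not restate them.
3. **Named facts on a datum**: the display (C.5), **Lemma C.18**, and the two printed attributes of Def. C.19's presheaf
   (l. 4954) as `Prop`-valued predicates `IsoC5AsPrinted D`, `LemC18AsPrinted D`, `DefC19SeparatedAsPrinted D`,
   `DefC19ProperIffAsPrinted D`.  NOTHING IS ASSERTED: no declaration here has type `… D` for any `D`; a consumer takes
   `(h : LemC18AsPrinted D)` for ITS OWN datum `D` (as with `PropC5AsPrinted`).  NO proofs, no `sorry`, no `axiom`, no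
   `instance`, no notation (TYPER LINT RULE).

## The printed text (verbatim from `FJcycle.tex`, macros resolved: `\rV`=`V`, `\bW`=`𝕎`, `\bA`=`𝔸`, `\rG`=`G`, `\rH`=`H`,
## `\rM`=`M`, `\cM`=`𝓜`, `\cW`=`𝒲`, `\tc`=`c`, `\sig`=`sig`, `\Sh`=`Sh`, `\tq`=`q`, `\bq`=`𝐪`, `\et`=`ét`, `\fp`=`𝔭`, `\fq`=`𝔮`)

**§C.3 standing data** (p. 112–113; l. 4779–4787): «Consider • a hermitian space `V, ( , )_V` over `E` of rank `n`, • a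
rational skew-hermitian space `𝕎₀^∞, ⟨ , ⟩₀` over `𝔸_E^∞ = E ⊗_ℚ 𝔸^∞` of rank `1` with the group of similitude `ℍ₀^∞`, • a
CM type `Φ` of `E` such that `𝒲(𝕎₀^∞, Φ^c)` is nonempty.  We now equip `𝕎^∞ := V ⊗_E 𝕎₀^∞` with a rational skew-hermitian
form over `𝔸_E^∞` […] `Tr_{E/ℚ}(( , )_V ⊗_E ⟨ , ⟩₀^†)` […].  By a similar construction, we obtain a map `𝒲(𝕎₀^∞, Φ^c) →
𝒲(𝕎^∞, Ψ)` sending `W₀` to `W`, where `Ψ = sig_{V,Φ}` (C.1).  Take an element `W₀ ∈ 𝒲(𝕎₀^∞, Φ^c)` with `H₀` its group of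
similitude.  We obtain three Shimura data: `(G, h♭_{V,Φ})`, `(H₀, h_{W₀,Φ^c})`, and `(H, h_{W,Ψ})` with reflex fields
`E♭_{V,Φ}`, `E_Φ`, and `E_Ψ = E_{V,Φ}`, respectively.»  (§C.2, p. 110; l. 4683: «Let `E_Ψ` be the fixed field of the
stabilizer of `Ψ` in `Gal(ℂ/ℚ)`.»)

**LEMMA C.14** (p. 113; l. 4789–4791): «Let `E♯_{V,Φ}` be the subfield of `ℂ` generated by `E♭_{V,Φ}` and `E_Φ`.  Then
`E♯_{V,Φ}` contains `E_{V,Φ}`.»  Proof (l. 4793–4795): «By definition, the subgroup of `Gal(ℂ/ℚ)` fixing `E♯_{V,Φ}`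
stabilizes both `sig♭_{V,Φ}` and `Φ`. Thus, it stabilizes `sig_{V,Φ}`. The lemma follows.»

**REMARK C.15** (p. 113; l. 4797–4799): «In the main part of the article, the hermitian space `V` we encounter will have
signature `(n−1,1)` at one place `τ ∈ Φ_F` and `(n,0)` elsewhere for some `n ≥ 2`. Then for whatever `Φ`, we have
`E♭_{V,Φ} = τ'(E)`, where `τ' ∈ Φ_E` is either place above `τ`. However, it is possible that `⋂_Φ E♯_{V,Φ}` strictly contains
`τ'(E)`, where `Φ` runs over all CM types of `E`.»

**Standing text** (p. 113–114; l. 4801–4825): «Now we consider the reductive group `G♯ := G × H₀` over `ℚ`. Put `h♯_Φ :=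
(h♭_{V,Φ}, h_{W₀,Φ^c})`. Then we have a product Shimura data `(G♯, h♯_Φ)`, whose reflex field is `E♯_{V,Φ}`. On the other
hand, there is a homomorphism `q_W : G♯ = G × H₀ → H` induced by taking tensor product. It is clear that `q_W ∘ h♯_Φ =
h_{W,Ψ}`. To summarize, we have the following diagram of Shimura data (C.3) [`(G, h♭_{V,Φ}) ←q_V− (G♯, h♯_Φ) −q_{W₀}→
(H₀, h_{W₀,Φ^c})`, `(G♯, h♯_Φ) −q_W→ (H, h_{W,Ψ})`].  For neat open compact subgroups `K ⊆ G(𝔸^∞)`, `L₀ ⊆ H₀(𝔸^∞)`, and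
`L ⊆ H(𝔸^∞)` satisfying `q_W(K × L₀) ⊆ L`, we have the following diagram of Shimura varieties induced from (C.3) (C.4)
[`Sh(G, h♭_{V,Φ})_K ⊗_{E♭_{V,Φ}} E♯_{V,Φ} ←q_V− Sh(G♯, h♯_Φ)_{K×L₀} −q_{W₀}→ Sh(H₀, h_{W₀,Φ^c})_{L₀} ⊗_{E_Φ} E♯_{V,Φ}`,
`Sh(G♯, h♯_Φ)_{K×L₀} −q_W→ Sh(H, h_{W,Ψ})_L ⊗_{E_{V,Φ}} E♯_{V,Φ}`] in view of Lemma C.14, in which `(q_V, q_{W₀})` induces an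
isomorphism (C.5) `Sh(G♯, h♯_Φ)_{K×L₀} ≃ (Sh(G, h♭_{V,Φ})_K ⊗_{E♭_{V,Φ}} E♯_{V,Φ}) ×_{E♯_{V,Φ}} (Sh(H₀, h_{W₀,Φ^c})_{L₀} ⊗_{E_Φ}
E♯_{V,Φ})` in `Sch_{/E♯_{V,Φ}}`, functorial in `K`, `L₀`, and under Hecke translations.  The Shimura variety
`Sh(G♯, h♯_Φ)_{K×L₀}` has a moduli interpretation as well.»

**DEFINITION C.16** (pp. 114–115; l. 4827–4857; `𝕎₁^∞`, `L₁`, `ℍ₁^∞` sic in print = `𝕎₀^∞`, `L₀`, `ℍ₀^∞`): «For open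
compact subgroups `K ⊆ G(𝔸^∞)` and `L ⊆ ℍ₁^∞(𝔸^∞)`, we define a presheaf `M(V, 𝕎₁^∞, Φ)_{K,L₁}` on `Sch'_{/E♯_{V,Φ}}` as
follows: For every object `S ∈ Sch'_{/E♯_{V,Φ}}`, we let `M(V, 𝕎₁^∞, Φ)_{K,L₁}(S)` be the set of equivalence classes of
octuples `(A₀, i₀, λ₀, η₀; A, i, λ, η)`, where • `(A₀, i₀)` is an `(E, Φ^c)`-abelian scheme over `S`, • `λ₀` is a
polarization of `(A₀, i₀)`, • `η₀` is an `L₀`-level structure for `(A₀, i₀, λ₀)`, • `(A, i)` is an `(E, sig_{V,Φ})`-abelian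
scheme over `S`, • `λ` is a polarization of `(A, i)`, • for chosen geometric point `s` on every connected component of `S`,
`η` is a `π₁(S, s)`-invariant `K`-orbit of isometries `V ⊗_ℚ 𝔸^∞ ⥲ Hom_{E⊗_ℚ𝔸^∞}(H₁^{ét}(A_{0s}, 𝔸^∞), H₁^{ét}(A_s, 𝔸^∞))` of
hermitian spaces over `𝔸_E^∞`. Here, the hermitian pairing on the latter space is given by the formula `(x, y) ↦
i₀^{−1}((λ_{0*})^{−1} ∘ y^∨ ∘ λ_* ∘ x) ∈ i₀^{−1} End_{E⊗_ℚ𝔸^∞}(H₁^{ét}(A_{0s}, 𝔸^∞)) = 𝔸_E^∞`.  Two octuples `(A₀, i₀, λ₀, η₀;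
A, i, λ, η)` and `(A₀', i₀', λ₀', η₀'; A', i', λ', η')` are equivalent if there are isogenies `φ₀ : A₀ → A₀'` and `φ : A → A'`
such that • there exists `c ∈ ℚ^×` such that `φ₀^∨ ∘ λ₀' ∘ φ₀ = c λ₀` and `φ^∨ ∘ λ' ∘ φ = c λ`, • for every `e ∈ E`, we
have `φ₀ ∘ i₀(e) = i₀'(e) ∘ φ₀` and `φ ∘ i(e) = i'(e) ∘ φ`, • the `K`-orbit of maps `x ↦ φ_* ∘ η(x) ∘ (φ_{0*})^{−1}` for
`x ∈ V ⊗_ℚ 𝔸^∞` coincides with `η'`.»  (Def. C.10, p. 110; l. 4685–4695: `(E,Ψ)`-abelian scheme `(A, i)` over `S` —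
`i : E → End_S(A)_ℚ` with `char(i(e) | Lie_S(A)) = ∏_{τ ∈ Φ_F} (T − τ^+(e))^{p_τ} (T − τ^−(e))^{q_τ}` — and polarization
`λ ∘ i(e) = i(e^c)^∨ ∘ λ`; typed by TL-t04.)

**REMARK C.17** (p. 115; l. 4860–4862): «The Shimura variety `Sh(G♯, h♯_Φ)_{K×L₁}` and its moduli interpretation were
first introduced in [BHK⁺20] when `F = ℚ`, and in [RSZ20] for more general CM extension `E/F`.»  (Bibliographic; INDEX.)

**LEMMA C.18** (p. 115; l. 4865–4872): «Let the notation be as above. We have a canonical isomorphism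
`M(V, 𝕎₀^∞, Φ)_{K,L₀} ≃ (Sh(G, h♭_{V,Φ})_K ⊗_{E♭_{V,Φ}} E♯_{V,Φ}) ×_{E♯_{V,Φ}} (M(𝕎₀^∞, Φ^c)_{L₀} ⊗_{E_Φ} E♯_{V,Φ})` in
`Sch_{/E♯_{V,Φ}}`, functorial in `K`, `L₀`, and under Hecke translations.»  Proof (l. 4874–4894): moduli maps `q`, `q₀`;
«Since `(q, q₀)` induces a closed embedding, the functor `M(V, 𝕎₀^∞, Φ)_{K,L₀}` is representable»; (C.6)
`M(V, 𝕎₀^∞, Φ)_{K,L₀} ≃ ∐_{W₀ ∈ 𝒲(𝕎₀^∞, Φ^c)} Sh(G♯, h♯_Φ)_{K×L₀}`; combine with (C.5) and [Kot92]'s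
`M(𝕎₀^∞, Φ^c)_{L₀} ≃ ∐_{W₀} Sh(H₀, h_{W₀,Φ^c})_{L₀}` (§C.2, p. 112; l. 4753–4757).

**§C.4 preamble** (p. 116; l. 4902–4919): «We identify `E` as a subfield of `ℂ` via an element `τ' ∈ Φ_E`. We fix a
hermitian space `V` over `E` that has signature `(n−1,1)` at `τ := τ'|_F` and `(n,0)` at other places.  We first review
the integral models of `M(V, 𝕎₀^∞, Φ)_{K,L₀}` in Definition C.16 at good primes, where we assume `τ' ∈ Φ`. Let `𝔭` be a
prime of `F` such that • `𝔭` is inert [in] `E`, • the underlying rational prime `p` is odd and unramified in `E`, • we may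
choose a self-dual lattice `Λ_𝔮` in `V ⊗_F F_𝔮` for every `𝔮 ∈ 𝔭̲`, where `𝔭̲` denotes the set of all primes of `F` above `p`
that are inert in `E`, • `L₀ = L₀^p × (L₀)_p` in which `(L₀)_p` is the stabilizer of a self-dual lattice in `𝕎₀^∞ ⊗_{𝔸^∞}
ℚ_p`, and `L₀^p` is sufficiently small.  Fix an isomorphism between `E`-extensions `ℂ` and `E_𝔭^{ac}`. We denote by `Spl_p`
the set of primes of `F` above `p` that are split in `E`. We also assume that elements in `Φ` inducing the same prime in
`Spl_p` induce the same prime of `E` (under the fixed isomorphism between `ℂ` and `E_𝔭^{ac}`).  Denote by `E♯_{V,Φ,𝔭}` the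
completion of `E♯_{V,Φ}` in `E_𝔭^{ac}`. We now consider subgroups `K` of the form `K = K^p × K_p^{𝔭̲} × K_{𝔭̲}`, where `K_{𝔭̲} =
∏_{𝔮 ∈ 𝔭̲} K_𝔮` in which `K_𝔮` is the stabilizer of `Λ_𝔮`, and `K^p` is sufficiently small. For `𝔮 ∈ Spl_p`, we denote by `𝔮^−`
the unique prime of `E` that is in `Φ` and regard `K_p^{𝔭̲}` a subgroup of `∏_{𝔮 ∈ Spl_p} GL_{E_{𝔮^−}}(V ⊗_E E_{𝔮^−})`.  The
following definition is a special case of the discussion in [RSZ20, Section 4.1] (but with a slightly finer level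
structure at `Spl_p`).»

**DEFINITION C.19** (pp. 116–117; l. 4921–4952): «We define a presheaf `𝓜(V, 𝕎₀^∞, Φ)_{K,L₀}` on `Sch'_{/O_{E♯_{V,Φ,𝔭}}}` as
follows: For every object `S ∈ Sch'_{/O_{E♯_{V,Φ,𝔭}}}`, we let `𝓜(V, 𝕎₀^∞, Φ)_{K,L₀}(S)` be the set of equivalence classes
of nonuples `(A₀, i₀, λ₀, η₀^p; A, i, λ, η^p, η_p^{spl})`, where • `(A₀, i₀)` is an `(E, Φ^c)`-abelian scheme over `S` (in the
sense of Remark C.13), • `λ₀` is a `𝔭̲`-principal polarization of `(A₀, i₀)`, • `η₀^p` is an `L₀^p`-level structure for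
`(A₀, i₀, λ₀)`, • `(A, i)` is an `(E, sig_{V,Φ})`-abelian scheme over `S` (in the sense of Remark C.13), • `λ` is a
`p`-principal polarization of `(A, i)`, • for chosen geometric point `s` on every connected component of `S`, – `η^p` is a
`π₁(S, s)`-invariant `K^p`-orbit of isometries `V ⊗_ℚ 𝔸^{∞,p} ⥲ Hom_{E⊗_ℚ𝔸^{∞,p}}(H₁^{ét}(A_{0s}, 𝔸^{∞,p}), H₁^{ét}(A_s,
𝔸^{∞,p}))` of hermitian spaces over `E ⊗_ℚ 𝔸^{∞,p}`. Here, the hermitian pairing is defined similarly as in Definition C.16,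
– `η_p^{spl}` is a `π₁(S, s)`-invariant `K_p^{𝔭̲}`-orbit of isomorphisms `∏_{𝔮 ∈ Spl_p} V ⊗_E E_{𝔮^−} ⥲ ∏_{𝔮 ∈ Spl_p}
Hom_{O_{E_{𝔮^−}}}(A_{0s}[(𝔮^−)^∞], A_s[(𝔮^−)^∞]) ⊗_{O_{E_{𝔮^−}}} E_{𝔮^−}` of `∏_{𝔮 ∈ 𝔭̲} E_{𝔮^−}`-modules. Note that due to the
signature condition in Definition C.12, both `A_{0s}[(𝔮^−)^∞]` and `A_s[(𝔮^−)^∞]` are étale `O_{E_{𝔮^−}}`-modules.  The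
equivalence relation is defined in a similar way as in Definition C.16 except that we require the isogeny `φ₀` (resp. `φ`)
to be coprime to `p` (resp. `𝔭̲`), and `c ∈ ℤ_{(p)}^×`.»  Then (p. 117; l. 4954–4958): «The presheaf `𝓜(V, 𝕎₀^∞, Φ)_{K,L₀}`
is a separated scheme in `Sch'_{/O_{E♯_{V,Φ,𝔭}}}`, which is proper if and only if `V` is anisotropic. By Definition C.19 and
Remark C.13, we have a canonical morphism (C.7) `𝐪₀ : 𝓜(V, 𝕎₀^∞, Φ)_{K,L₀} → 𝓜(𝕎₀^∞, Φ^c)_{L₀} ⊗_{O_{E_Φ,(p)}} O_{E♯_{V,Φ,𝔭}}`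
extending the projection to the second factor in Lemma C.18.»

## INDEX (printed item ↦ declaration of this file; «cite» = typed elsewhere in the tree, cited by name, not restated)

| item | where | decl |
|---|---|---|
| `E_Φ` (§C.2 l. 4683 convention, used at l. 4787) | p. 110 ∕ 113 | `cmTypeElt`, `cmReflexField` (REAL) |
| `E♯_{V,Φ}` (Lem. C.14) | p. 113 | `sharpReflexField` (REAL) |
| **Lem. C.14** | p. 113 | `LemC14AsPrinted` (closed named fact) |
| **Rem. C.15**, first sentence | p. 113 | `RemC15AsPrinted` (closed named fact); second sentence quoted only (no proof in print) |
| `G(𝔸^∞)`, `H₀(𝔸^∞)`, levels `K`, `L₀`, `K × L₀` | pp. 113–114 | cite `HermSpace.Gfin`; `H0fin` (= tree `Aux.torusFinAdelic`), `LevelK`, `LevelL0`, `SharpLevel` |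
| `E♭ ≤ E♯`, `E_Φ ≤ E♯`, `− ⊗_{E♭} E♯`, `− ⊗_{E_Φ} E♯` | p. 114 | `inclFlat`, `inclCM`, `bcFlat`, `bcCM` (REAL) |
| (C.3)/(C.4) objects `Sh(G,h♭)_K`, `Sh(H₀,h_{W₀,Φ^c})_{L₀}`, `Sh(G♯,h♯_Φ)_{K×L₀}`, `q_V`, `q_{W₀}` | pp. 113–114 | `SecC3Data.S` = cite `HermSpace.ShimuraSystemFlat` (`DefC1toC3`), `shVOf`∕`SecC3Data.ShV`; ⟨CARRIER⟩ fields `Sh0`, `ShSharp`, `qV`, `qW0` |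
| **(C.5)** | p. 114 | `IsoC5AsPrinted D` (at neat levels, `SecC3Data.IsNeatK`∕`IsNeatL0`; ED.2) |
| **Def. C.16** `M(V,𝕎₀^∞,Φ)_{K,L₀}` | pp. 114–115 | ⟨CARRIER⟩ `SecC3Data.M` (octuple description quoted on the field) |
| **Rem. C.17** | p. 115 | bibliographic — this INDEX only |
| **Lem. C.18** | p. 115 | `LemC18AsPrinted D` (at neat levels; ED.2) |
| §C.4 preamble + **Def. C.19** `𝓜(V,𝕎₀^∞,Φ)_{K,L₀}`, (C.7) | pp. 116–117 | `DefC19Data` (REAL hypotheses, REAL place `placeSharp` + `algOsharp` (ED.2), ⟨CARRIER⟩ `Osharp`, `𝓜`, `M0int`, `bq0`), `IsAnisotropic`, `DefC19SeparatedAsPrinted D`, `DefC19ProperIffAsPrinted D` |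
| Def. C.1 `E_{V,Φ}`, `E♭_{V,Φ}`; (C.1) `sig_{V,Φ}`; Rem. C.2 signature `(n−1,1)`; `Sh(G,h♭_{V,Φ})_K` | §C.1 | cite `HermSpace.reflexField`, `reducedReflexField`, `sigElt`, `IsSignatureN1At`, `ShimuraSystemFlat` (`DefC1toC3`) |
| Def. C.10, C.11, C.12, Rem. C.13 | §C.2 | cite TL-t04 ★ `AppendixC/SecC2Similitude` (tokens `W0inf`, `W0`, systems `Sh0`, `M0`, `M0int` here) |

NOT TYPED (recorded verbatim above, no carrier posited): the rational skew-hermitian form on `𝕎^∞ = V ⊗_E 𝕎₀^∞`, the map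
`𝒲(𝕎₀^∞,Φ^c) → 𝒲(𝕎^∞,Ψ)`, the datum `(H, h_{W,Ψ})`, `q_W` and the right-hand node of (C.3)/(C.4) (no statement of §C.3 about
them beyond their existence); the claim «`(G♯, h♯_Φ)` … whose reflex field is `E♯_{V,Φ}`» (no Shimura-datum vocabulary to
state it on); «under Hecke translations» in (C.5) and Lem. C.18 (the carriers carry no Hecke action; a consumer needing it
posits it on its own datum, citing l. 4823 ∕ l. 4871); the second sentence of Rem. C.15 (an unproved possibility remark);
in Def. C.19: the fixed isomorphism `ℂ ≃ E_𝔭^{ac}`, the condition on `Φ` at `Spl_p`, the self-dual lattices `Λ_𝔮` and the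
shape `K = K^p × K_p^{𝔭̲} × K_{𝔭̲}`, `L₀ = L₀^p × (L₀)_p` (carried as the posited predicates `IsAdmK`, `IsAdmL0`, whose
docstrings quote them), and «extending the projection to the second factor in Lemma C.18» for (C.7).
Bridges NOT proved here (each is a theorem, not a definition): `cmReflexField Φ` = the tree's classical complex reflex
field `Literature.NumberTheory.ComplexMultiplication.traceField Φ` ([Shimura1998] §8.3 Prop. 28 with `Fix(Aut(ℂ/k)) = k`);
`cmReflexField Φ = cmReflexField Φ^c`; in the situation of Rem. C.15 the in-tree development
`Literature/AlgebraicGeometry/ShimuraVarieties/UnitaryAuxiliaryTorusDatum` ∕ `UnitaryAuxiliaryTorusReflexNorm` ∕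
`UnitaryAuxiliaryReflexBookkeeping` (`Aux.reflexField = τ(L) ⊔ traceField Φ`, its lemmas citing Lem. C.14 ∕ Rem. C.15)
is the signature-`(n−1,1)` special case of `sharpReflexField`.

HC_CM is proved only modulo the 7 printed citations (2 remaining: hLiu418 = stmt-HodgeConjecture-24832, h413 =
stmt-HodgeConjecture-24833) until rung 0 closes; nothing in this file is a proof of anything.

## References

* [Liu2021] Y. Liu, Camb. J. Math. 9 (2021) 1–147, arXiv:2102.11518 — App. C §C.3 pp. 112–116 (Lem. C.14, Rem. C.15,
  (C.3)–(C.6), Def. C.16, Rem. C.17, Lem. C.18), §C.4 pp. 116–117 (Def. C.19, (C.7)); §C.2 p. 110 (`E_Ψ`), p. 112 ([Kot92]).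
* [Kot92] R. Kottwitz, *Points on some Shimura varieties over finite fields*, JAMS 5 (1992); [BHK⁺20]; [RSZ20] M. Rapoport,
  B. Smithling, W. Zhang, *Arithmetic diagonal cycles on unitary Shimura varieties*, Compos. Math. 156 (2020), §4.1 — as
  cited by Liu at l. 4741, 4861, 4919 (attributions printed by Liu; not read for this file).
* [Shimura1998] G. Shimura, *Abelian varieties with complex multiplication and modular functions*, §8.3 Prop. 28 (the
  classical reflex field; tree file `Literature/NumberTheory/ComplexMultiplication/ComplexReflexField`).
-/

noncomputable section

open CategoryTheory AlgebraicGeometry NumberField IsDedekindDomain MonoidalCategory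
open Literature.AlgebraicGeometry.Motives (CMType SchemeOver)

namespace Literature.NumberTheory.Automorphic.Liu2021.AppendixC.SecC3Connection

variable (F E : Type) [Field F] [NumberField F] [IsTotallyReal F] [Field E] [NumberField E] [Algebra F E]
  [IsTotallyComplex E] [Algebra.IsQuadraticExtension F E]

/-! ## §0. REAL reflex fields: `E_Φ` (as printed in App. C) and `E♯_{V,Φ}`; Lemma C.14 and Remark C.15 as named facts -/

/-- **A CM type `Φ` as an element of `ℕ[Φ_E]`**, `Σ_{φ ∈ Φ} 1·φ` (the indicator of `Φ ⊆ Φ_E` as a finitely supported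
function; `Φ_E = (E →+* ℂ)` is finite for a number field).  This is how §C.2 reads a type as a signature element `Ψ` (for
`Ψ = Φ^c`: `p_τ = 1`, `q_τ = 0` for every `τ`, l. 4677–4683) and how the stabilizer «of `Φ`» in the proof of Lem. C.14
(l. 4794) is meant. [cite: Liu2021, App. C §C.2 (p. 110), FJcycle.tex l. 4677–4683] -/
def cmTypeElt (Φ : CMType E) : (E →+* ℂ) →₀ ℕ :=
  Finsupp.ofSupportFinite (Φ.1.indicator fun _ => (1 : ℕ)) (Set.toFinite _)

/-- **`E_Φ`, the reflex field of the CM type `Φ` AS PRINTED in App. C**: «the fixed field of the stabilizer of `Ψ` in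
`Gal(ℂ/ℚ)`» (§C.2, l. 4683) for `Ψ = Φ ∈ ℕ[Φ_E]` — the reflex field of the datum `(H₀, h_{W₀,Φ^c})` (l. 4787; the stabilizers
of `Φ` and of `Φ^c = Φ_E ∖ Φ` coincide).  Built on `DefC1toC3`'s `Gal(ℂ/ℚ) = ℂ ≃ₐ[ℚ] ℂ`-action on `ℕ[Φ_E]` and its
`stabilizer`, exactly like `HermSpace.reflexField` (Def. C.1); it is, with the same body, the value at `Ψ = cmTypeElt E Φ` of the
sibling's `SecC2Similitude.typeReflexField E Ψ` (★ §C.2 file, landed the same day; not imported here).  Classically equal to the tree's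
`Literature.NumberTheory.ComplexMultiplication.traceField Φ = ℚ(tr_Φ(E))` ([Shimura1998] §8.3 Prop. 28); that equality is a
theorem and is NOT asserted here. [cite: Liu2021, App. C §C.2 (p. 110) and §C.3 (p. 113), FJcycle.tex l. 4683, 4787] -/
def cmReflexField (Φ : CMType E) : IntermediateField ℚ ℂ :=
  IntermediateField.fixedField (stabilizer E (cmTypeElt E Φ))

/-- **`E♯_{V,Φ}`, «the subfield of `ℂ` generated by `E♭_{V,Φ}` and `E_Φ`»** (Lem. C.14, l. 4789): the supremum of the two
intermediate fields `E♭_{V,Φ} = V.reducedReflexField Φ` (Def. C.1, `DefC1toC3`) and `E_Φ = cmReflexField Φ` in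
`IntermediateField ℚ ℂ` (every subfield of `ℂ` contains `ℚ`, so this IS the subfield they generate).  It is the reflex field
of the product datum `(G♯, h♯_Φ)` (l. 4801, a printed claim not typed here) and the base field of Def. C.16.
[cite: Liu2021, Lem. C.14 (p. 113), FJcycle.tex l. 4789] -/
def sharpReflexField (V : HermSpace F E) (Φ : CMType E) : IntermediateField ℚ ℂ :=
  V.reducedReflexField Φ ⊔ cmReflexField E Φ

/-- **[Liu2021, Lemma C.14] EXACTLY AS PRINTED** (p. 113; l. 4789–4791): «Let `E♯_{V,Φ}` be the subfield of `ℂ` generated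
by `E♭_{V,Φ}` and `E_Φ`. Then `E♯_{V,Φ}` contains `E_{V,Φ}`.» — for every CM extension `E/F` (App. C l. 4550: `F` totally
real, `E/F` totally imaginary quadratic), every hermitian space `V` over `E` (l. 4558, rank `n ≥ 1`) and every CM type `Φ`:
`E_{V,Φ} ≤ E♯_{V,Φ}` as subfields of `ℂ` (`HermSpace.reflexField` of Def. C.1 ≤ `sharpReflexField`).  A CLOSED named fact
(all objects REAL); NOT proved here (printed proof: the subgroup fixing `E♯` stabilizes `sig♭_{V,Φ}` and `Φ`, hence
`sig_{V,Φ} = sig♭_{V,Φ} + Σ_τ p_τ τ^+` — this uses `p_τ + q_τ = n` for all `τ`). [cite: Liu2021, Lem. C.14 (p. 113)] -/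
def LemC14AsPrinted : Prop :=
  ∀ (F E : Type) [Field F] [NumberField F] [IsTotallyReal F] [Field E] [NumberField E] [Algebra F E]
    [IsTotallyComplex E] [Algebra.IsQuadraticExtension F E] (V : HermSpace F E) (Φ : CMType E),
    V.reflexField Φ ≤ sharpReflexField F E V Φ

/-- **[Liu2021, Remark C.15], first sentence, EXACTLY AS PRINTED** (p. 113; l. 4797–4798): «the hermitian space `V` …
will have signature `(n−1,1)` at one place `τ ∈ Φ_F` and `(n,0)` elsewhere for some `n ≥ 2`. Then for whatever `Φ`, we have
`E♭_{V,Φ} = τ'(E)`, where `τ' ∈ Φ_E` is either place above `τ`.» — typed: for `V` with `2 ≤ n` and `V.IsSignatureN1At τ`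
(Rem. C.2's hypothesis, `DefC1toC3`), for every CM type `Φ` and every complex embedding `τ'` with `π τ' = τ` (`restr`, the
restriction map of l. 4550), the reduced reflex field `E♭_{V,Φ}` equals the subfield `τ'(E) ⊆ ℂ` (`RingHom.fieldRange`).
The second printed sentence («it is possible that `⋂_Φ E♯_{V,Φ}` strictly contains `τ'(E)`») is an unproved aside and is
NOT typed.  CLOSED named fact; not proved here. [cite: Liu2021, Rem. C.15 (p. 113)] -/
def RemC15AsPrinted : Prop :=
  ∀ (F E : Type) [Field F] [NumberField F] [IsTotallyReal F] [Field E] [NumberField E] [Algebra F E]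
    [IsTotallyComplex E] [Algebra.IsQuadraticExtension F E] (V : HermSpace F E) (τ : F →+* ℝ),
    2 ≤ V.n → V.IsSignatureN1At τ →
      ∀ (Φ : CMType E) (τ' : E →+* ℂ), restr F E τ' = τ → (V.reducedReflexField Φ).toSubfield = τ'.fieldRange

/-! ## §1. REAL index groups and base changes: `G(𝔸^∞)`, `H₀(𝔸^∞)`, levels, `E♭ ≤ E♯`, `E_Φ ≤ E♯` -/

/-- **`H₀(𝔸^∞)`, the finite-adèlic points of the group of similitude `H₀` of the rank-one rational skew-hermitian space
`W₀`** (l. 4787; Def. C.11 with `n = 1`, p. 110–111: `H₀(R) = {h ∈ GL_{E⊗_ℚR}(W₀ ⊗_ℚ R) | ⟨hx, hy⟩ = ν(h)⟨x, y⟩, ν(h) ∈ R^×}`;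
for rank one `GL_{E⊗R}(W₀ ⊗ R) = (E ⊗_ℚ R)^×` and `⟨hx, hy⟩_{W₀} = ⟨h h^c x, y⟩_{W₀}`, so `H₀(R) = {h | h h^c ∈ R^×}`
WHATEVER `W₀` is) — REAL: the tree's torus `T₀(𝔸_f) = {z ∈ 𝔸_{E,f}^× | z·(c ⊗ 1)(z) ∈ 𝔸_{ℚ,f}^×}` =
`UnitaryCanonicalModel.Aux.torusFinAdelic E` of `Literature/AlgebraicGeometry/ShimuraVarieties/UnitaryAuxiliaryTorusDatum`
(CITED, not restated; `E` is a CM field by Mathlib `IsCMField.ofCMExtension F E`), a subgroup of the finite idèles of `E`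
with its subspace topology.  Its open compact subgroups `L₀` index `Sh(H₀, h_{W₀,Φ^c})_{L₀}` and `M(𝕎₀^∞, Φ^c)_{L₀}`
(`ℍ₀^∞(𝔸^∞) ≃ H₀(𝔸^∞)`, §C.2 l. 4737). [cite: Liu2021, App. C §C.3 (p. 113) and Def. C.11 (p. 110), FJcycle.tex l. 4787] -/
def H0fin : Subgroup (FiniteAdeleRing (𝓞 E) E)ˣ :=
  letI : IsCMField E := IsCMField.ofCMExtension F E
  Literature.AlgebraicGeometry.ShimuraVarieties.UnitaryCanonicalModel.Aux.torusFinAdelic E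

/-- **The levels `K`: open compact subgroups of `G(𝔸^∞) = U(V)(𝔸_F^∞)`** (l. 4810: «neat open compact subgroups
`K ⊆ G(𝔸^∞)`»; Def. C.16 l. 4828: «open compact subgroups `K ⊆ G(𝔸^∞)`»), on the REAL group `HermSpace.Gfin V` of
`DefC1toC3` (l. 4599), as the poset `C5.OpenCompactSubgroup` of `PropC5` (inclusion order; a functor out of it is a
projective system).  Neatness is where the Shimura varieties are DEFINED (l. 4810); the carriers below are total and a
consumer restricts to neat `K` (READING as in `PropC5`, R2). [cite: Liu2021, App. C §C.3 (p. 113–114), FJcycle.tex l. 4810, 4828] -/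
abbrev LevelK (V : HermSpace F E) : Type := C5.OpenCompactSubgroup ↥V.Gfin

/-- **The levels `L₀`: open compact subgroups of `H₀(𝔸^∞)`** (l. 4810, 4828), on the REAL group `H0fin`.
[cite: Liu2021, App. C §C.3 (p. 113–114), FJcycle.tex l. 4810, 4828] -/
abbrev LevelL0 : Type := C5.OpenCompactSubgroup ↥(H0fin F E)

/-- **The levels `K × L₀` of `G♯ = G × H₀`** (l. 4801, 4810: `Sh(G♯, h♯_Φ)_{K×L₀}`; Def. C.16: `M(V, 𝕎₀^∞, Φ)_{K,L₀}`): pairs,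
with the product category structure («functorial in `K`, `L₀`», l. 4823, 4871 = natural in both). [cite: Liu2021, App. C §C.3 (p. 113–115), FJcycle.tex l. 4801–4825] -/
abbrev SharpLevel (V : HermSpace F E) : Type := LevelK F E V × LevelL0 F E

/-- The REAL inclusion `E♭_{V,Φ} ≤ E♯_{V,Φ}` as a ring homomorphism (`E♯ = E♭ ⊔ E_Φ`; Mathlib `IntermediateField.inclusion`),
along which «`Sh(G, h♭_{V,Φ})_K ⊗_{E♭_{V,Φ}} E♯_{V,Φ}`» (C.4)/(C.5)/Lem. C.18 is formed. [cite: Liu2021, Lem. C.14 and (C.4) (p. 113–114)] -/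
def inclFlat (V : HermSpace F E) (Φ : CMType E) : ↥(V.reducedReflexField Φ) →+* ↥(sharpReflexField F E V Φ) :=
  (IntermediateField.inclusion (le_sup_left : V.reducedReflexField Φ ≤ sharpReflexField F E V Φ)).toRingHom

/-- The REAL inclusion `E_Φ ≤ E♯_{V,Φ}` as a ring homomorphism, along which «`⊗_{E_Φ} E♯_{V,Φ}`» of (C.4)/(C.5)/Lem. C.18 is
formed. [cite: Liu2021, Lem. C.14 and (C.4) (p. 113–114)] -/
def inclCM (V : HermSpace F E) (Φ : CMType E) : ↥(cmReflexField E Φ) →+* ↥(sharpReflexField F E V Φ) :=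
  (IntermediateField.inclusion (le_sup_right : cmReflexField E Φ ≤ sharpReflexField F E V Φ)).toRingHom

/-- **`− ⊗_{E♭_{V,Φ}} E♯_{V,Φ}`** (C.4), (C.5), Lem. C.18: base change of `E♭_{V,Φ}`-schemes to `E♯_{V,Φ}` along `inclFlat` — the
fibre product with `Spec E♯` over `Spec E♭` (`C5.baseChangeAlong` of `PropC5` = Mathlib `Over.pullback`).
[cite: Liu2021, App. C (C.4)–(C.5) (p. 114) and Lem. C.18 (p. 115)] -/
def bcFlat (V : HermSpace F E) (Φ : CMType E) :
    SchemeOver ↥(V.reducedReflexField Φ) ⥤ SchemeOver ↥(sharpReflexField F E V Φ) :=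
  C5.baseChangeAlong (inclFlat F E V Φ)

/-- **`− ⊗_{E_Φ} E♯_{V,Φ}`** (C.4), (C.5), Lem. C.18: base change of `E_Φ`-schemes to `E♯_{V,Φ}` along `inclCM`.
[cite: Liu2021, App. C (C.4)–(C.5) (p. 114) and Lem. C.18 (p. 115)] -/
def bcCM (V : HermSpace F E) (Φ : CMType E) :
    SchemeOver ↥(cmReflexField E Φ) ⥤ SchemeOver ↥(sharpReflexField F E V Φ) :=
  C5.baseChangeAlong (inclCM F E V Φ)

variable {F E} in
/-- **`K ↦ Sh(G, h♭_{V,Φ})_K` as a functor on the open compact levels**, READ OFF the sibling's ⟨CARRIER⟩ datum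
`HermSpace.ShimuraSystemFlat V Φ` of `DefC1toC3` (l. 4599: «a projective system of schemes `{Sh(G, h♭_{V,Φ})_K}_K` … over
`E♭_{V,Φ}`», its fields `Sh`, `tr`, `tr_refl`, `tr_trans`): objects `S.Sh K`, morphisms the transition maps (a morphism
`K ⟶ K'` of levels is `K ≤ K'`).  ED.2: this PINS the left node of (C.3)∕(C.4) to the tree's existing carrier (ED.1 posited
a second, free functor). [cite: Liu2021, App. C §C.1 l. 4599 (p. 108) and (C.4) (p. 114)] -/
def shVOf {V : HermSpace F E} {Φ : CMType E} (S : V.ShimuraSystemFlat Φ) :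
    LevelK F E V ⥤ SchemeOver ↥(V.reducedReflexField Φ) where
  obj K := S.Sh K.1
  map {K K'} f := S.tr (K := K'.1) (K' := K.1) f.le
  map_id K := S.tr_refl K.1
  map_comp f g := S.tr_trans f.le g.le

/-! ## §2. The data of §C.3 (hypothesis structure; ⟨CARRIER⟩ = posited datum standing for a printed object) -/

/-- **The data of [Liu2021] App. C §C.3**, in paper order, over a hermitian space `V` over `E` (l. 4781; REAL, `HermSpace`
of `DefC1toC3`) and a CM type `Φ` of `E` (l. 4785).  Fields marked ⟨CARRIER⟩ are posited data standing for printed objects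
that Mathlib ∕ the tree do not construct (the canonical models `Sh(H₀, h_{W₀,Φ^c})_{L₀}`, `Sh(G♯, h♯_Φ)_{K×L₀}`, Kottwitz's
PEL moduli scheme `M(𝕎₀^∞, Φ^c)_{L₀}` of Def. C.12 and the moduli scheme `M(V, 𝕎₀^∞, Φ)_{K,L₀}` of Def. C.16); their docstrings
quote the printed definitions.  The system `{Sh(G, h♭_{V,Φ})_K}_K` is the sibling's carrier `V.ShimuraSystemFlat Φ` (field
`S`, ED.2).  Everything they are INDEXED by and BASED over is REAL
(`LevelK`, `LevelL0`, `SharpLevel`; the subfields `E♭_{V,Φ}`, `E_Φ`, `E♯_{V,Φ}` of `ℂ`).  Nothing is asserted by this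
structure; the printed CLAIMS about these data are the predicates `IsoC5AsPrinted`, `LemC18AsPrinted` below.
[cite: Liu2021, App. C §C.3 (pp. 112–115), FJcycle.tex l. 4779–4872] -/
structure SecC3Data (V : HermSpace F E) (Φ : CMType E) : Type 1 where
  /-- ⟨CARRIER⟩ (token) `𝕎₀^∞`: «a rational skew-hermitian space `𝕎₀^∞, ⟨ , ⟩₀` over `𝔸_E^∞ = E ⊗_ℚ 𝔸^∞` of rank `1` with the
  group of similitude `ℍ₀^∞`» (l. 4783; Def. C.11, p. 110: «a free `E ⊗_ℚ R`-module `W` of rank `n` together with a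
  `R`-bilinear skew-symmetric non-degenerate pairing `⟨ , ⟩_W : W × W → R` satisfying `⟨ex, y⟩_W = ⟨x, e^c y⟩_W`», `R = 𝔸^∞`,
  `n = 1`), subject to «`𝒲(𝕎₀^∞, Φ^c)` is nonempty» (l. 4785).  Typed REAL by TL-t04 (★ `SecC2Similitude.RatSkewHermSpace F E Afin 1`); a token
  here because no statement of §C.3 sees `𝕎₀^∞` except through `H₀(𝔸^∞)` (REAL, `H0fin`) and the systems below. -/
  W0inf : Type
  /-- ⟨CARRIER⟩ (token) the CHOSEN `W₀`: «Take an element `W₀ ∈ 𝒲(𝕎₀^∞, Φ^c)` with `H₀` its group of similitude» (l. 4787) —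
  its existence is the printed hypothesis «`𝒲(𝕎₀^∞, Φ^c)` is nonempty» (l. 4785; `𝒲(𝕎^∞, Ψ)` = §C.2, p. 111, l. 4705–4711:
  similarity classes of rational skew-hermitian `W` over `E` with `W ⊗_E 𝔸_E^∞` similar to `𝕎^∞` and signature `(p_τ, q_τ)` of
  `⟨ , i·⟩_W` on `W ⊗_{E,τ^−} ℂ`). -/
  W0 : Type
  /-- PINNED (ED.2) **`{Sh(G, h♭_{V,Φ})_K}_K`, the left node of (C.3)∕(C.4)**: the sibling's ⟨CARRIER⟩ datum
  `HermSpace.ShimuraSystemFlat V Φ` of `DefC1toC3` (§C.1, l. 4579–4599: «quasi-projective and smooth over `E♭_{V,Φ}` of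
  dimension `Σ_{τ ∈ Φ_F} p_τ q_τ`, indexed by neat open compact subgroups `K` of `G(𝔸^∞) = U(V)(𝔸_F^∞)`» — carried WITH those
  printed attributes and its «neat» predicate `IsNeat`, READING R8).  ED.1 posited a second, free functor `ShV`; now `ShV`,
  `IsNeatK` are READ OFF this field (`shVOf`, `SecC3Data.ShV`, `SecC3Data.IsNeatK` below). -/
  S : V.ShimuraSystemFlat Φ
  /-- ⟨CARRIER⟩ «neat open compact subgroups … `L₀ ⊆ H₀(𝔸^∞)`» (l. 4810: the levels at which (C.4), (C.5) — and, «the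
  notation [being] as above», Lem. C.18 — are printed): a posited predicate on the REAL levels `L₀` ([Liu2021] does not
  define «neat»; READING R8, as `ShimuraSystemFlat.IsNeat` and `SecC2Similitude.SecC2Data.IsLevel`).  ED.2 (ED.1 claimed (C.5)
  and Lem. C.18 at every open compact level). [cite: Liu2021, App. C §C.3 (p. 113–114), FJcycle.tex l. 4810] -/
  IsNeatL0 : LevelL0 F E → Prop
  /-- ⟨CARRIER⟩ `L₀ ↦ Sh(H₀, h_{W₀,Φ^c})_{L₀}`, the projective system of (zero-dimensional) Shimura varieties of the datum
  `(H₀, h_{W₀,Φ^c})` over its reflex field `E_Φ` (l. 4787; §C.2 l. 4713–4737 with `Ψ = Φ^c`, `n = 1`: «a projective system of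
  schemes `{Sh(H, h_{W,Ψ})_L}_L`, quasi-projective and smooth over `E_Ψ` of dimension `Σ p_τ q_τ`» `= 0`) — the lower node of
  (C.3)/(C.4).  (Its complex points are the tree's `UnitaryCanonicalModel.Aux.classGroup E L₀ = T₀(ℚ)\T₀(𝔸_f)/L₀`.) -/
  Sh0 : LevelL0 F E ⥤ SchemeOver ↥(cmReflexField E Φ)
  /-- ⟨CARRIER⟩ `L₀ ↦ M(𝕎₀^∞, Φ^c)_{L₀}`, Kottwitz's PEL moduli scheme of Def. C.12 ([Kot92]) for `(𝕎₀^∞, Φ^c)` over `E_Φ`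
  (p. 111–112; l. 4741–4757: quadruples `(A, i, λ, η)` up to isogeny; «a scheme if `L` is sufficiently small, and we have a
  canonical isomorphism `M(𝕎^∞, Ψ)_L ≃ ∐_{W ∈ 𝒲(𝕎^∞,Ψ)} Sh(H, h_{W,Ψ})_L` functorial in `L`»), the right-hand factor of
  Lem. C.18.  Typed by TL-t04 (★ `SecC2Similitude.SecC2Data`, presheaf `PointSet` ∕ `pull` ∕ `res`); a carrier functor here
  (meaningful at neat `L₀`, `IsNeatL0`). -/
  M0 : LevelL0 F E ⥤ SchemeOver ↥(cmReflexField E Φ)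
  /-- ⟨CARRIER⟩ `(K, L₀) ↦ Sh(G♯, h♯_Φ)_{K×L₀}`, the Shimura varieties of the product datum `(G♯, h♯_Φ) = (G × H₀,
  (h♭_{V,Φ}, h_{W₀,Φ^c}))` over its reflex field `E♯_{V,Φ}` (l. 4801–4810), the middle node of (C.4) (total; meaningful at
  neat `(K, L₀)`). -/
  ShSharp : SharpLevel F E V ⥤ SchemeOver ↥(sharpReflexField F E V Φ)
  /-- ⟨CARRIER⟩ `q_V : Sh(G♯, h♯_Φ)_{K×L₀} → Sh(G, h♭_{V,Φ})_K ⊗_{E♭_{V,Φ}} E♯_{V,Φ}` of (C.4), induced by the projection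
  `q_V : G♯ → G` of (C.3) (l. 4803–4817), natural in `(K, L₀)`; its target is REAL-ly built from `ShV` (`bcFlat`). -/
  qV : ShSharp ⟶ CategoryTheory.Prod.fst (LevelK F E V) (LevelL0 F E) ⋙ shVOf S ⋙ bcFlat F E V Φ
  /-- ⟨CARRIER⟩ `q_{W₀} : Sh(G♯, h♯_Φ)_{K×L₀} → Sh(H₀, h_{W₀,Φ^c})_{L₀} ⊗_{E_Φ} E♯_{V,Φ}` of (C.4), induced by `q_{W₀} : G♯ → H₀` of
  (C.3) (l. 4803–4817), natural in `(K, L₀)`. -/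
  qW0 : ShSharp ⟶ CategoryTheory.Prod.snd (LevelK F E V) (LevelL0 F E) ⋙ Sh0 ⋙ bcCM F E V Φ
  /-- ⟨CARRIER⟩ **[Liu2021, Definition C.16]** `(K, L₀) ↦ M(V, 𝕎₀^∞, Φ)_{K,L₀}`: the presheaf on `Sch'_{/E♯_{V,Φ}}` of
  equivalence classes of octuples `(A₀, i₀, λ₀, η₀; A, i, λ, η)` — «`(A₀, i₀)` is an `(E, Φ^c)`-abelian scheme over `S`, `λ₀` is
  a polarization of `(A₀, i₀)`, `η₀` is an `L₀`-level structure for `(A₀, i₀, λ₀)`, `(A, i)` is an `(E, sig_{V,Φ})`-abelian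
  scheme over `S`, `λ` is a polarization of `(A, i)`, for chosen geometric point `s` on every connected component of `S`, `η`
  is a `π₁(S, s)`-invariant `K`-orbit of isometries `V ⊗_ℚ 𝔸^∞ ⥲ Hom_{E⊗_ℚ𝔸^∞}(H₁^{ét}(A_{0s}, 𝔸^∞), H₁^{ét}(A_s, 𝔸^∞))` of
  hermitian spaces over `𝔸_E^∞`» with the hermitian pairing `(x, y) ↦ i₀^{−1}((λ_{0*})^{−1} ∘ y^∨ ∘ λ_* ∘ x)`, two octuples
  being equivalent through isogenies `φ₀`, `φ` with a common `c ∈ ℚ^×` (full text in the module docstring; pp. 114–115,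
  l. 4827–4857) — carried as the `E♯_{V,Φ}`-SCHEME representing it («Since `(q, q₀)` induces a closed embedding, the functor
  `M(V, 𝕎₀^∞, Φ)_{K,L₀}` is representable», proof of Lem. C.18, l. 4874–4880 — printed under «the notation … as above», i.e. at
  neat `(K, L₀)`; the carrier is total and its values at other levels are never used), functorially in `(K, L₀)`.  Abelian schemes with
  `E`-action, Kottwitz's signature condition, polarizations and level structures over a general base are the tree's
  `Literature/AlgebraicGeometry/AbelianSchemes/*` (`AbelianSchemeOver.RingAction` cites Def. C.10 (1)); the moduli FUNCTOR
  itself is not constructed in the tree. [cite: Liu2021, Def. C.16 (p. 114)] -/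
  M : SharpLevel F E V ⥤ SchemeOver ↥(sharpReflexField F E V Φ)

variable {F E}

/-- `K ↦ Sh(G, h♭_{V,Φ})_K` on the open compact levels, read off the pinned datum `D.S` (`shVOf`; ED.2 — in ED.1 a free
functor field of the same name and type). [cite: Liu2021, App. C (C.4) (p. 114)] -/
abbrev SecC3Data.ShV {V : HermSpace F E} {Φ : CMType E} (D : SecC3Data F E V Φ) :
    LevelK F E V ⥤ SchemeOver ↥(V.reducedReflexField Φ) :=
  shVOf D.S

/-- «neat open compact subgroups `K ⊆ G(𝔸^∞)`» (l. 4810), read off the pinned datum: `D.S.IsNeat K` (READING R8 of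
`DefC1toC3`; ED.2). [cite: Liu2021, App. C §C.3 (p. 113–114), FJcycle.tex l. 4810] -/
abbrev SecC3Data.IsNeatK {V : HermSpace F E} {Φ : CMType E} (D : SecC3Data F E V Φ) (K : LevelK F E V) : Prop :=
  D.S.IsNeat K.1

/-! ## §3. The printed claims of §C.3 as predicates on the datum -/

/-- **[Liu2021, App. C (C.5)] AS PRINTED** (p. 114; l. 4819–4823): «`(q_V, q_{W₀})` induces an isomorphism
`Sh(G♯, h♯_Φ)_{K×L₀} ≃ (Sh(G, h♭_{V,Φ})_K ⊗_{E♭_{V,Φ}} E♯_{V,Φ}) ×_{E♯_{V,Φ}} (Sh(H₀, h_{W₀,Φ^c})_{L₀} ⊗_{E_Φ} E♯_{V,Φ})` in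
`Sch_{/E♯_{V,Φ}}`, functorial in `K`, `L₀`, and under Hecke translations.» — printed «For neat open compact subgroups
`K ⊆ G(𝔸^∞)`, `L₀ ⊆ H₀(𝔸^∞)`» (l. 4810).  Typed: for every NEAT level `(K, L₀)` (`IsNeatK`, `IsNeatL0`; ED.2 — ED.1 had every
open compact level, stronger than printed) the morphism into the fibre product over `Spec E♯_{V,Φ}` (the cartesian-monoidal
`⊗` of `SchemeOver E♯`, `CartesianMonoidalCategory.lift`) induced by the components of `q_V` and `q_{W₀}` is an isomorphism;
functoriality in `(K, L₀)` is the naturality of the carriers `qV`, `qW0` (then the inverses are natural on the neat levels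
too).  «under Hecke translations» is NOT typed (module docstring).  Not asserted; a consumer takes `(h : IsoC5AsPrinted D)`.
[cite: Liu2021, App. C (C.5) (p. 114)] -/
def IsoC5AsPrinted {V : HermSpace F E} {Φ : CMType E} (D : SecC3Data F E V Φ) : Prop :=
  ∀ j : SharpLevel F E V, D.IsNeatK j.1 → D.IsNeatL0 j.2 →
    IsIso (CartesianMonoidalCategory.lift (D.qV.app j) (D.qW0.app j))

/-- **[Liu2021, Lemma C.18] EXACTLY AS PRINTED** (p. 115; l. 4865–4872): «Let the notation be as above. We have a canonical
isomorphism `M(V, 𝕎₀^∞, Φ)_{K,L₀} ≃ (Sh(G, h♭_{V,Φ})_K ⊗_{E♭_{V,Φ}} E♯_{V,Φ}) ×_{E♯_{V,Φ}} (M(𝕎₀^∞, Φ^c)_{L₀} ⊗_{E_Φ} E♯_{V,Φ})`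
in `Sch_{/E♯_{V,Φ}}`, functorial in `K`, `L₀`, and under Hecke translations.» — «the notation … as above» = the neat levels
`K`, `L₀` of l. 4810 (where `Sh(G, h♭_{V,Φ})_K`, §C.1 l. 4599, and (C.5) live); ED.2 guards by `IsNeatK`, `IsNeatL0` (ED.1 had
every open compact level, stronger than printed).  Typed on the datum `D`: there is a family of isomorphisms of
`E♯_{V,Φ}`-schemes `e_{(K,L₀)} : M(V, 𝕎₀^∞, Φ)_{K,L₀} ≅ (Sh(G, h♭)_K ⊗_{E♭} E♯) ⊗ (M(𝕎₀^∞, Φ^c)_{L₀} ⊗_{E_Φ} E♯)`, one for each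
NEAT level (`⊗` = fibre product over `Spec E♯`, the cartesian monoidal structure of `SchemeOver`; base changes REAL, `bcFlat` ∕
`bcCM`), natural in `(K, L₀)`: for every morphism `f = (K ≤ K', L₀ ≤ L₀')` between neat levels the square with the transition
maps `M(f)` and `Sh(f.1) ⊗ M₀(f.2)` commutes («functorial in `K`, `L₀`»).  «canonical» has no further formal content here;
«under Hecke translations» is NOT typed (module docstring).  Not asserted, not proved (printed proof: (C.6) + (C.5) +
[Kot92]); a consumer takes `(h : LemC18AsPrinted D)` for its own `D`. [cite: Liu2021, Lem. C.18 (p. 115)] -/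
def LemC18AsPrinted {V : HermSpace F E} {Φ : CMType E} (D : SecC3Data F E V Φ) : Prop :=
  ∃ e : ∀ j : SharpLevel F E V, D.IsNeatK j.1 → D.IsNeatL0 j.2 →
      (D.M.obj j ≅ (bcFlat F E V Φ).obj (D.ShV.obj j.1) ⊗ (bcCM F E V Φ).obj (D.M0.obj j.2)),
    ∀ (j j' : SharpLevel F E V) (hK : D.IsNeatK j.1) (hL : D.IsNeatL0 j.2) (hK' : D.IsNeatK j'.1)
      (hL' : D.IsNeatL0 j'.2) (f : j ⟶ j'),
      D.M.map f ≫ (e j' hK' hL').hom =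
        (e j hK hL).hom ≫ ((bcFlat F E V Φ).map (D.ShV.map f.1) ⊗ₘ (bcCM F E V Φ).map (D.M0.map f.2))

/-- From Lem. C.18's isomorphism: «the projection to the second factor in Lemma C.18» (l. 4958), the `E♯_{V,Φ}`-morphism
`M(V, 𝕎₀^∞, Φ)_{K,L₀} → M(𝕎₀^∞, Φ^c)_{L₀} ⊗_{E_Φ} E♯_{V,Φ}` that (C.7) extends — REAL given a witness `e` of `LemC18AsPrinted D`
(composition with `CartesianMonoidalCategory.snd`).  A definition, not a claim. [cite: Liu2021, Lem. C.18 (p. 115) and (C.7) (p. 117)] -/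
def sndOfLemC18 {V : HermSpace F E} {Φ : CMType E} (D : SecC3Data F E V Φ) (j : SharpLevel F E V)
    (e : D.M.obj j ≅ (bcFlat F E V Φ).obj (D.ShV.obj j.1) ⊗ (bcCM F E V Φ).obj (D.M0.obj j.2)) :
    D.M.obj j ⟶ (bcCM F E V Φ).obj (D.M0.obj j.2) :=
  e.hom ≫ CartesianMonoidalCategory.snd _ _

/-! ## §4. The opening of §C.4: the standing hypotheses at `𝔭` and Definition C.19 -/

variable (F E) in
/-- «`V` is anisotropic» (l. 4954: «proper if and only if `V` is anisotropic»): the hermitian form has no nonzero isotropic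
vector, `(x, x)_V = 0 → x = 0` (REAL, on `HermSpace` of `DefC1toC3`). [cite: Liu2021, App. C §C.4 (p. 117), FJcycle.tex l. 4954] -/
def IsAnisotropic (V : HermSpace F E) : Prop :=
  ∀ x : V.V, V.form x x = 0 → x = 0

variable (F E) in
/-- **The data and standing hypotheses of [Liu2021] §C.4, first paragraph, and Definition C.19** (pp. 116–117;
l. 4902–4952), extending the §C.3 datum.  REAL fields: `τ' ∈ Φ` with `V` of signature `(n−1,1)` at `τ = τ'|_F` and `(n,0)`
elsewhere (l. 4902–4905); the prime `𝔭` of `F` (a nonzero prime of `𝓞 F`, Mathlib `HeightOneSpectrum`) inert in `E`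
(`𝔭 𝓞_E` is prime); its residue characteristic `p`, odd, unramified in `E` (every prime of `𝓞 E` above `p` has ramification
index `1`, Mathlib `Ideal.ramificationIdx`); the place `placeSharp` of `E♯_{V,Φ}` above `p` at which the completion
`E♯_{V,Φ,𝔭}` is taken, with the structure map `algOsharp : 𝓞_{E♯_{V,Φ}} → O_{E♯_{V,Φ,𝔭}}` local at it (ED.2).  ⟨CARRIER⟩ fields:
the admissible levels (`IsAdmK`, `IsAdmL0`, quoting the printed shapes and the self-dual lattices), the completed base ring
`O_{E♯_{V,Φ,𝔭}}` itself (`Osharp`), the integral moduli scheme `𝓜` of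
Def. C.19, the integral Kottwitz model `𝓜(𝕎₀^∞, Φ^c)_{L₀} ⊗_{O_{E_Φ,(p)}} O_{E♯_{V,Φ,𝔭}}` of Rem. C.13 (`M0int`) and the morphism
`𝐪₀` of (C.7) (`bq0`).  The printed assumptions with no carrier («Fix an isomorphism between `E`-extensions `ℂ` and
`E_𝔭^{ac}`»; «elements in `Φ` inducing the same prime in `Spl_p` induce the same prime of `E`») are part of the MEANING of
`Osharp` and `𝓜` (module docstring, NOT TYPED).  Nothing is asserted; the printed attributes of `𝓜` are the predicates
`DefC19SeparatedAsPrinted`, `DefC19ProperIffAsPrinted`. [cite: Liu2021, Def. C.19 (p. 116), FJcycle.tex l. 4902–4958] -/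
structure DefC19Data (V : HermSpace F E) (Φ : CMType E) extends SecC3Data F E V Φ where
  /-- «We identify `E` as a subfield of `ℂ` via an element `τ' ∈ Φ_E`» (l. 4902). REAL. -/
  τ' : E →+* ℂ
  /-- «where we assume `τ' ∈ Φ`» (l. 4905). REAL. -/
  τ'_mem : τ' ∈ Φ.1
  /-- «a hermitian space `V` over `E` that has signature `(n−1,1)` at `τ := τ'|_F` and `(n,0)` at other places» (l. 4902) —
  Rem. C.2's hypothesis `IsSignatureN1At` of `DefC1toC3` at `π τ' = restr F E τ'`. REAL. -/
  sig : V.IsSignatureN1At (restr F E τ')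
  /-- «Let `𝔭` be a prime of `F`» (l. 4905): a nonzero prime ideal of `𝓞 F`. REAL. -/
  𝔭 : HeightOneSpectrum (𝓞 F)
  /-- «`𝔭` is inert [in] `E`» (l. 4907): the extended ideal `𝔭 𝓞_E` is a prime ideal. REAL. -/
  inert : (𝔭.asIdeal.map (algebraMap (𝓞 F) (𝓞 E))).IsPrime
  /-- «the underlying rational prime `p`» of `𝔭` (l. 4909). REAL. -/
  p : ℕ
  /-- `p` is prime. REAL. -/
  p_prime : p.Prime
  /-- `p` lies under `𝔭`: `𝔭 ∩ ℤ = (p)` (Mathlib `Ideal.under`). REAL. -/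
  under_eq : 𝔭.asIdeal.under ℤ = Ideal.span {(p : ℤ)}
  /-- «`p` is odd» (l. 4909). REAL. -/
  p_odd : p ≠ 2
  /-- «`p` is … unramified in `E`» (l. 4909): every prime of `𝓞 E` above `p` has ramification index `1` over `ℤ`
  (Mathlib `Ideal.ramificationIdx`). REAL. -/
  unram : ∀ 𝔓 : HeightOneSpectrum (𝓞 E), 𝔓.asIdeal.under ℤ = Ideal.span {(p : ℤ)} → 𝔓.asIdeal.ramificationIdx ℤ = 1
  /-- ⟨CARRIER⟩ the admissible levels `K`: «we may choose a self-dual lattice `Λ_𝔮` in `V ⊗_F F_𝔮` for every `𝔮 ∈ 𝔭̲`, where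
  `𝔭̲` denotes the set of all primes of `F` above `p` that are inert in `E`» (l. 4911) and «subgroups `K` of the form
  `K = K^p × K_p^{𝔭̲} × K_{𝔭̲}`, where `K_{𝔭̲} = ∏_{𝔮 ∈ 𝔭̲} K_𝔮` in which `K_𝔮` is the stabilizer of `Λ_𝔮`, and `K^p` is sufficiently
  small … regard `K_p^{𝔭̲}` a subgroup of `∏_{𝔮 ∈ Spl_p} GL_{E_{𝔮^−}}(V ⊗_E E_{𝔮^−})`» (l. 4917) — a posited predicate on
  the REAL levels (local components of `U(V)(𝔸_F^∞)` and lattices in `V ⊗_F F_𝔮` are not available to define it). -/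
  IsAdmK : LevelK F E V → Prop
  /-- ⟨CARRIER⟩ the admissible levels `L₀`: «`L₀ = L₀^p × (L₀)_p` in which `(L₀)_p` is the stabilizer of a self-dual lattice
  in `𝕎₀^∞ ⊗_{𝔸^∞} ℚ_p`, and `L₀^p` is sufficiently small» (l. 4913) — a posited predicate on the REAL levels `L₀`. -/
  IsAdmL0 : LevelL0 F E → Prop
  /-- REAL (ED.2): the place of `E♯_{V,Φ}` at which «`E♯_{V,Φ,𝔭}`, the completion of `E♯_{V,Φ}` in `E_𝔭^{ac}`» (l. 4917) is
  taken — the nonzero prime of `𝓞_{E♯_{V,Φ}}` induced on the subfield `E♯_{V,Φ} ⊆ ℂ` by the FIXED «isomorphism between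
  `E`-extensions `ℂ` and `E_𝔭^{ac}`» (l. 4915) and the valuation of `E_𝔭^{ac}` (Mathlib `HeightOneSpectrum` of the ring of
  integers of the subfield `E♯_{V,Φ}` of `ℂ`).  That it lies above `𝔭` itself (not only above `p`) is part of its MEANING: to say
  it one needs `τ'(E) ⊆ E♯_{V,Φ}`, which holds here by Rem. C.15 (a named fact, `RemC15AsPrinted`), so it is recorded, NOT TYPED. -/
  placeSharp : HeightOneSpectrum (𝓞 ↥(sharpReflexField F E V Φ))
  /-- REAL (ED.2): `placeSharp` lies above the rational prime `p` of `𝔭` (l. 4909, 4917). -/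
  placeSharp_under : placeSharp.asIdeal.under ℤ = Ideal.span {(p : ℤ)}
  /-- ⟨CARRIER⟩ `O_{E♯_{V,Φ,𝔭}}`: the ring of integers of «`E♯_{V,Φ,𝔭}`, the completion of `E♯_{V,Φ}` in `E_𝔭^{ac}`» (l. 4917),
  i.e. the `placeSharp`-adic completion of `𝓞_{E♯_{V,Φ}}`, a bundled commutative ring (the base of Def. C.19's presheaf,
  «`Sch'_{/O_{E♯_{V,Φ,𝔭}}}`»).  A carrier and not Mathlib's `HeightOneSpectrum.adicCompletionIntegers`, which needs
  `IsDedekindDomain (𝓞 E♯_{V,Φ})`, i.e. that the subfield `E♯_{V,Φ}` of `ℂ` is a number field — true (reflex fields lie in the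
  Galois closure of `E`) but a theorem the tree does not have; pinned to `placeSharp` by the two fields below (ED.2). -/
  Osharp : CommRingCat.{0}
  /-- REAL-typed (ED.2): the structure map `𝓞_{E♯_{V,Φ}} → O_{E♯_{V,Φ,𝔭}}` of the completion. -/
  algOsharp : 𝓞 ↥(sharpReflexField F E V Φ) →+* Osharp
  /-- (ED.2) `O_{E♯_{V,Φ,𝔭}}` is local at `placeSharp`: an integer of `E♯_{V,Φ}` becomes a unit in the completion iff it lies
  outside `placeSharp` (the completed local ring of `𝓞_{E♯_{V,Φ}}` at `placeSharp`). -/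
  algOsharp_isUnit_iff : ∀ x : 𝓞 ↥(sharpReflexField F E V Φ), IsUnit (algOsharp x) ↔ x ∉ placeSharp.asIdeal
  /-- ⟨CARRIER⟩ **[Liu2021, Definition C.19]** `(K, L₀) ↦ 𝓜(V, 𝕎₀^∞, Φ)_{K,L₀}`: the presheaf on `Sch'_{/O_{E♯_{V,Φ,𝔭}}}` of
  equivalence classes of nonuples `(A₀, i₀, λ₀, η₀^p; A, i, λ, η^p, η_p^{spl})` — «`(A₀, i₀)` an `(E, Φ^c)`-abelian scheme over
  `S` (in the sense of Remark C.13), `λ₀` a `𝔭̲`-principal polarization, `η₀^p` an `L₀^p`-level structure, `(A, i)` an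
  `(E, sig_{V,Φ})`-abelian scheme over `S` (in the sense of Remark C.13), `λ` a `p`-principal polarization, `η^p` a
  `π₁(S, s)`-invariant `K^p`-orbit of isometries `V ⊗_ℚ 𝔸^{∞,p} ⥲ Hom_{E⊗_ℚ𝔸^{∞,p}}(H₁^{ét}(A_{0s}, 𝔸^{∞,p}), H₁^{ét}(A_s, 𝔸^{∞,p}))`
  of hermitian spaces, `η_p^{spl}` a `π₁(S, s)`-invariant `K_p^{𝔭̲}`-orbit of isomorphisms `∏_{𝔮 ∈ Spl_p} V ⊗_E E_{𝔮^−} ⥲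
  ∏_{𝔮 ∈ Spl_p} Hom_{O_{E_{𝔮^−}}}(A_{0s}[(𝔮^−)^∞], A_s[(𝔮^−)^∞]) ⊗ E_{𝔮^−}`», equivalence through isogenies `φ₀` coprime to `p`,
  `φ` coprime to `𝔭̲`, `c ∈ ℤ_{(p)}^×` (full text in the module docstring; pp. 116–117, l. 4921–4952; «a special case of the
  discussion in [RSZ20, Section 4.1]», l. 4919) — carried as the `O_{E♯_{V,Φ,𝔭}}`-SCHEME it is (l. 4954: «is a separated
  scheme»), for every level `(K, L₀)` (meaningful at admissible ones, `IsAdmK`, `IsAdmL0`), functorially.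
  [cite: Liu2021, Def. C.19 (p. 116)] -/
  𝓜 : SharpLevel F E V ⥤ SchemeOver ↥Osharp
  /-- ⟨CARRIER⟩ `L₀ ↦ 𝓜(𝕎₀^∞, Φ^c)_{L₀} ⊗_{O_{E_Φ,(p)}} O_{E♯_{V,Φ,𝔭}}`: Kottwitz's smooth integral model of Rem. C.13 (p. 112;
  l. 4761–4771: quadruples `(A, i, λ, η^p)` with `i : O_{E,(p)} → End_S(A) ⊗ ℤ_{(p)}`, `λ` `p`-principal; «a smooth separated
  scheme in `Sch_{/O_{E_Ψ,(p)}}` if `L` is sufficiently small; and is functorial in `L`») for `(𝕎₀^∞, Φ^c)`, base-changed to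
  `O_{E♯_{V,Φ,𝔭}}` — the target of (C.7). -/
  M0int : LevelL0 F E ⥤ SchemeOver ↥Osharp
  /-- ⟨CARRIER⟩ **(C.7)** `𝐪₀ : 𝓜(V, 𝕎₀^∞, Φ)_{K,L₀} → 𝓜(𝕎₀^∞, Φ^c)_{L₀} ⊗_{O_{E_Φ,(p)}} O_{E♯_{V,Φ,𝔭}}`, «a canonical morphism …
  extending the projection to the second factor in Lemma C.18» (p. 117; l. 4954–4958), forgetting `(A, i, λ, η^p, η_p^{spl})`,
  natural in `(K, L₀)`.  The extension property (generic fibre = `sndOfLemC18`) is NOT typed. -/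
  bq0 : 𝓜 ⟶ CategoryTheory.Prod.snd (LevelK F E V) (LevelL0 F E) ⋙ M0int

/-- **[Liu2021], the sentence after Def. C.19, first half, AS PRINTED** (p. 117; l. 4954): «The presheaf `𝓜(V, 𝕎₀^∞, Φ)_{K,L₀}`
is a separated scheme in `Sch'_{/O_{E♯_{V,Φ,𝔭}}}`» — typed: at every admissible level `(K, L₀)` the structure morphism
`𝓜(V, 𝕎₀^∞, Φ)_{K,L₀} → Spec O_{E♯_{V,Φ,𝔭}}` is separated (Mathlib `IsSeparated`).  Not asserted; a consumer takes
`(h : DefC19SeparatedAsPrinted D)`. [cite: Liu2021, Def. C.19 (p. 116–117), FJcycle.tex l. 4954] -/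
def DefC19SeparatedAsPrinted {V : HermSpace F E} {Φ : CMType E} (D : DefC19Data F E V Φ) : Prop :=
  ∀ j : SharpLevel F E V, D.IsAdmK j.1 → D.IsAdmL0 j.2 → IsSeparated (D.𝓜.obj j).hom

/-- **[Liu2021], the sentence after Def. C.19, second half, AS PRINTED** (p. 117; l. 4954): «… which is proper if and only if
`V` is anisotropic» — typed: at every admissible level, `𝓜(V, 𝕎₀^∞, Φ)_{K,L₀} → Spec O_{E♯_{V,Φ,𝔭}}` is proper (Mathlib
`IsProper`) iff `V` is anisotropic (`IsAnisotropic`, REAL).  Not asserted. [cite: Liu2021, Def. C.19 (p. 116–117), FJcycle.tex l. 4954] -/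
def DefC19ProperIffAsPrinted {V : HermSpace F E} {Φ : CMType E} (D : DefC19Data F E V Φ) : Prop :=
  ∀ j : SharpLevel F E V, D.IsAdmK j.1 → D.IsAdmL0 j.2 → (IsProper (D.𝓜.obj j).hom ↔ IsAnisotropic F E V)

end Literature.NumberTheory.Automorphic.Liu2021.AppendixC.SecC3Connection

end
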